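import Summits.NavierStokesRegularity.NavierStokesRegularity.Theses.HodographBetchov
import HarnessLib.Audit

/-!
# `SlowClassProduction` (stmt-NavierStokesRegularity-15831) — birth skeleton `Lines/birth.lean`

Route `HodographBetchov`, crux 2 (rank 2): for every `ν, T > 0`, every classical solution `(u,p)`
of unforced Navier–Stokes on `ℝ³ × [0,T)` that is Leray–Hopf from a rapidly decaying datum, and
every speed level `l > 0`, the enstrophy production `P = ⟪ω, ∇u ω⟫` (`ω = curl u`) is integrable on
the SLOW space-time class `S_t = {(s,x) : 0 < s < t, |u(s,x)| ≤ l}` with `∫_{S_t} P ≤ C`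
uniformly in `t < T`.

LINE "parabolic trichotomy of the slow class at Reynolds number ≤ 1" (the route's own two-layer
plan `SlowClassProduction ⇐ DeepSlowBound → CollarProduction`, made checkable, with the initial
parabolic layer split off).  Fix a delay `τ ∈ (0,T)` and a radius `r` with `0 < r ≤ ν/l` and
`r² ≤ ν τ` (so the backward parabolic cylinder `Q_r(s,x) = [s − r²/ν, s] × B̄(x,r)` of a point with
`s ≥ τ` stays inside `[0,T) × ℝ³`, and `|u| ≤ l` on it means cylinder Reynolds number
`l r/ν ≤ 1`).  Every slow point `(s,x) ∈ S_t` is exactly one of: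
* INITIAL  — `s < τ`;
* DEEP     — `s ≥ τ` and `|u| ≤ l` on all of `Q_r(s,x)`;
* COLLAR   — `s ≥ τ` and `|u(s',y)| > l` at some `(s',y) ∈ Q_r(s,x)` (the parabolic `r`-collar
  of the fast set `{|u| > l}` inside the slow class).
The three stubs bound the production on the three pieces; the glue is the measure theory of the
partition (the deep piece is cut out of `S_t ∩ {s ≥ τ}` by a CLOSED, hence measurable, set:
continuity of `u` on `[0,T) × ℝ³` from `IsClassicalNSSolutionOn.smooth_velocity`).

* `stub_slabProduction` (KNOWN local theory, L in Lean): production is absolutely integrable on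
  every closed-in-time sub-slab `(0,t₁] × ℝ³`, `t₁ < T` (weak–strong uniqueness with the Kato /
  `H^k` solution from the smooth rapidly decaying datum, whose gradient is `L^∞ ∩ L²` on `[0,t₁]`;
  that the strong solution does not blow up before `T` uses joint smoothness on `[0,T) × ℝ³` plus
  far-field `ε`-regularity of the energy-class solution — Leray 1934 §§31–34, Serrin 1962,
  CKN 1982; tree: Kato maximal time / `hasSmoothExtensionPast_of_bounded`-type facts).
  Feeds the INITIAL piece (`S_t ∩ {s < τ} ⊆ (0,τ) × ℝ³`).
* `stub_deepSlowProduction` (A PRIORI, L; = route support `DeepSlowGradient` at level `ν/r ≥ l`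
  + the Leray–Hopf energy inequality): on the DEEP piece `|∇u| ≤ C(ν, r, ‖u₀‖₂)` (Serrin-type
  local regularity at cylinder Reynolds number `≤ 1`: canonical pressure split, local energy
  inequality, vorticity bootstrap), hence `|P| ≤ |ω|²|∇u| ≤ 2 C |∇u|²_F` and
  `∫∫ |∇u|²_F ≤ ‖u₀‖₂²/(2ν)`; so `∫_{S_t ∩ Deep} |P| ≤ C ‖u₀‖₂²/ν` uniformly in `t`.
* `stub_collarProduction` (OPEN — the content of the crux, isolated): for SOME admissible
  `(τ, r)` the production of the COLLAR piece has integral bounded above uniformly in `t < T`.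
  This is where `Literature.Barriers.NavierStokesRegularity.EnergySupercriticality` bites
  (critical a-priori statement; the collar's space-time measure is NOT controlled by
  `|F_l(t)| ≤ 2E₀/l²` for filamentary fast sets, and a strained near-stagnant collar — degenerate
  stagnation sheet between colliding structures — contributes `G²·l·Area`); nondegenerate
  stagnation points contribute only `≲ l³` per unit time (route CHEAPEST FALSIFIER), so the stub is
  not killed by Taylor–Green / Kida–Pelz symmetric candidates.  Given stubs 1–2 it is equivalent
  to the crux (the other two pieces are absolutely bounded), but not cheaply: no piece alone gives
  the crux or the summit (BC3 probes, NOTES.md).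

Glue: `SlowClassProduction_of_stubs` derives the crux statement (verbatim) from the three stub
STATEMENTS as hypotheses (real proof, no `sorry`): obtain `(τ, r, C₂)` from stub 3, `C₁` from
stub 2 at the same `(τ, r)`, `C₀ := ∫∫_{(0,τ)×ℝ³} |P|` from stub 1; then
`S_t = (S_t ∩ {s<τ}) ∪ (S_t ∩ Deep) ∪ (S_t ∩ Collar)` with the deep/collar cut realised by the
closed set `⋂_{σ ∈ [0,r²/ν], |η| ≤ r} {τ ≤ s ≤ t, |u(s−σ, x+η)| ≤ l}`, integrability of the union,
`∫_S = ∫_{S∩A} + ∫_{S∖A}` twice (`integral_inter_add_sdiff`), and `∫ P ≤ ∫ |P|` on the two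
absolutely bounded pieces; `C = C₀ + C₁ + C₂`.  `SlowClassProduction_of` restates the conclusion
BY NAME from the three declared stubs (A12 layer invariant: no `Prop` hypotheses, sorries only in
`stub_*`).

Disproof used: none — `ledger crux ls stmt-NavierStokesRegularity-15831` shows no workfiles (no
`Disproof.lean`, no Negative lemma, 2026-08-17); `ledger negatives --problem NavierStokesRegularity`
lists 4 refuted statements (SymmetryModuliCount 4055, PerpetualPump 1832, AdiabaticEddy 1429,
Blowup 0154) — none about velocity classes, production budgets or parabolic collars, and no stub is
an instance of any of them.  Evidence honoured: refuter route-review note (2026-08-16: signature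
elaborates, hypotheses satisfiable by the rest state, conclusion holds there) and grounder stamp
(NEW, open-problem-grade; nearest print Constantin1990 for the interface, Serrin1962 for the deep
part) — the trichotomy puts Serrin1962 in stub 2 and the interface in stub 3.

Sources: Serrin1962, CKN1982, Leray1934, KNSS2009 (stubs 1–2); Constantin1990, Miller2019,
Hou2022PotentiallySingularNS (stub 3); route file `Theses/HodographBetchov.lean` (TWO-LAYER PLAN,
NOT DECOMPOSED YET, CHEAPEST FALSIFIER); card
`Ideas/hodograph-degree-conditional-betchov-v2.md`.
-/

noncomputable section

-- the summit and its single problem share the name `NavierStokesRegularity` (D-0017 nested layout)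
set_option linter.dupNamespace false

namespace Summit.NavierStokesRegularity.NavierStokesRegularity.Cruxes.SlowClassProduction.Birth

open Set MeasureTheory Metric
open scoped ContDiff

/-! ## Stubs -/

/-- STUB 1 (KNOWN local theory; L in Lean).  **Production is absolutely integrable on every
closed-in-time sub-slab.**  For a classical Navier–Stokes solution (`f = 0`) on `ℝ³ × [0,T)` that is
Leray–Hopf from a rapidly decaying datum and every `0 < t₁ < T`, the enstrophy production
`⟪curl u, ∇u (curl u)⟫` is integrable on `(0,t₁) × ℝ³`.  Mechanism: by weak–strong uniqueness the
solution is the Kato/`H^k` solution from `u 0` on `[0,t₁]`, whose gradient is bounded and square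
integrable there, so `∫∫ |ω|²|∇u| ≤ 2‖∇u‖_∞ ∫∫ |∇u|²_F < ∞`; the strong solution cannot blow up at
some `T* ≤ t₁ < T` because `u` is jointly continuous on `[0,T) × ℝ³` (bounded on compact sets) and
bounded in the far field by `ε`-regularity of the energy-class solution (tails of
`∫∫ |u|^{10/3} + |p|^{5/3}`), while `T* < ∞` forces `‖u(t)‖_∞ → ∞`.  Used only through the INITIAL
piece `S_t ∩ {s < τ} ⊆ (0,τ) × ℝ³`. [Leray1934 §§31–34, Serrin1962, CKN1982, KNSS2009] -/
theorem stub_slabProduction :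
    ∀ (ν T : ℝ), 0 < ν → 0 < T →
      ∀ (u : ℝ → EuclideanSpace ℝ (Fin 3) → EuclideanSpace ℝ (Fin 3))
        (p : ℝ → EuclideanSpace ℝ (Fin 3) → ℝ),
        Literature.Analysis.FluidPDE.IsClassicalNSSolutionOn (Set.Ico 0 T) ν 0 u p →
        Literature.Analysis.FluidPDE.IsLerayHopfOn T ν 0 (u 0) u →
        Literature.Analysis.FluidPDE.HasRapidSpatialDecay (u 0) →
        ∀ t₁ : ℝ, 0 < t₁ → t₁ < T →
          MeasureTheory.IntegrableOn
            (fun z : ℝ × EuclideanSpace ℝ (Fin 3) =>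
              inner ℝ (Literature.Analysis.FluidPDE.curl (u z.1) z.2)
                (fderiv ℝ (u z.1) z.2 (Literature.Analysis.FluidPDE.curl (u z.1) z.2)))
            (Set.Ioo 0 t₁ ×ˢ (Set.univ : Set (EuclideanSpace ℝ (Fin 3)))) := by
  sorry

/-- STUB 2 (A PRIORI; L in Lean — the route's support `DeepSlowGradient` applied at the level
`ν/r ≥ l`, plus the energy inequality).  **Deep-slow production budget.**  Same class; for every
level `l > 0`, delay `τ ∈ (0,T)` and radius `r` with `0 < r ≤ ν/l`, `r² ≤ ν τ`, there is `C` such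
that for all `t < T` the production is integrable on the DEEP piece of the slow class —
`0 < s < t`, `|u(s,x)| ≤ l`, `s ≥ τ`, and `|u| ≤ l` on the whole backward cylinder
`[s − r²/ν, s] × B̄(x, r)` (cylinder Reynolds number `l r/ν ≤ 1`) — with `∫ |P| ≤ C`.
Mechanism: local regularity at Reynolds number `≤ 1` gives `|∇u(s,x)| ≤ C'(ν, r, ‖u 0‖₂)` at
every deep point (Serrin 1962: canonical pressure = local part from `|u| ≤ l` + harmonic far part
from the energy; local energy inequality; vorticity bootstrap), so `|P| ≤ |ω|²|∇u| ≤ 2C'|∇u|²_F`,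
and `∫₀ᵀ∫ |∇u|²_F ≤ ‖u 0‖₂²/(2ν)` by the Leray–Hopf energy inequality (the weak gradient is
`fderiv` for a classical solution); measurability of the deep piece: it is cut out of the slab by a
closed condition (continuity of `u` on `[0,T) × ℝ³`). [Serrin1962, CKN1982, KNSS2009, Leray1934] -/
theorem stub_deepSlowProduction :
    ∀ (ν T : ℝ), 0 < ν → 0 < T →
      ∀ (u : ℝ → EuclideanSpace ℝ (Fin 3) → EuclideanSpace ℝ (Fin 3))
        (p : ℝ → EuclideanSpace ℝ (Fin 3) → ℝ),
        Literature.Analysis.FluidPDE.IsClassicalNSSolutionOn (Set.Ico 0 T) ν 0 u p →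
        Literature.Analysis.FluidPDE.IsLerayHopfOn T ν 0 (u 0) u →
        Literature.Analysis.FluidPDE.HasRapidSpatialDecay (u 0) →
        ∀ l : ℝ, 0 < l → ∀ τ : ℝ, 0 < τ → τ < T → ∀ r : ℝ, 0 < r → r ≤ ν / l → r ^ 2 ≤ ν * τ →
          ∃ C : ℝ, ∀ t ∈ Set.Ico 0 T,
            MeasureTheory.IntegrableOn
              (fun z : ℝ × EuclideanSpace ℝ (Fin 3) =>
                inner ℝ (Literature.Analysis.FluidPDE.curl (u z.1) z.2)
                  (fderiv ℝ (u z.1) z.2 (Literature.Analysis.FluidPDE.curl (u z.1) z.2)))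
              ({z : ℝ × EuclideanSpace ℝ (Fin 3) | z.1 ∈ Set.Ioo 0 t ∧ ‖u z.1 z.2‖ ≤ l} ∩
                {z : ℝ × EuclideanSpace ℝ (Fin 3) | τ ≤ z.1 ∧
                  ∀ s ∈ Set.Icc (z.1 - r ^ 2 / ν) z.1, ∀ y ∈ Metric.closedBall z.2 r,
                    ‖u s y‖ ≤ l}) ∧
            ∫ z in ({z : ℝ × EuclideanSpace ℝ (Fin 3) | z.1 ∈ Set.Ioo 0 t ∧ ‖u z.1 z.2‖ ≤ l} ∩
                {z : ℝ × EuclideanSpace ℝ (Fin 3) | τ ≤ z.1 ∧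
                  ∀ s ∈ Set.Icc (z.1 - r ^ 2 / ν) z.1, ∀ y ∈ Metric.closedBall z.2 r,
                    ‖u s y‖ ≤ l}),
              |inner ℝ (Literature.Analysis.FluidPDE.curl (u z.1) z.2)
                (fderiv ℝ (u z.1) z.2 (Literature.Analysis.FluidPDE.curl (u z.1) z.2))| ≤ C := by
  sorry

/-- STUB 3 (OPEN — the content of the crux, hardest).  **Collar production budget.**  Same class;
for every level `l > 0` there are a delay `τ ∈ (0,T)`, a radius `r` with `0 < r ≤ ν/l`, `r² ≤ ν τ`,
and `C` such that for all `t < T` the production is integrable on the COLLAR piece of the slow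
class — `0 < s < t`, `|u(s,x)| ≤ l`, `s ≥ τ`, and `|u(s',y)| > l` at SOME point of the backward
cylinder `[s − r²/ν, s] × B̄(x, r)` (the parabolic `r`-collar of the fast set inside the slow
class) — with `∫ P ≤ C` (one-sided, as in the crux; by Betchov on velocity classes the slow-class
integral is `−4∫∫ det S`).  Why it might fail: exactly why the crux might — critical a-priori
statement (`EnergySupercriticality`); a strained near-stagnant collar (degenerate stagnation sheet,
contribution `G²·l·Area`) or a filamentary fast set with a fat collar; nondegenerate stagnation
points are harmless (`≲ l³` per unit time).  Given stubs 1–2 (absolutely bounded pieces) it is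
equivalent to the crux at level `l`, for any admissible `(τ, r)`. [Constantin1990, Miller2019,
Serrin1962, Hou2022PotentiallySingularNS] -/
theorem stub_collarProduction :
    ∀ (ν T : ℝ), 0 < ν → 0 < T →
      ∀ (u : ℝ → EuclideanSpace ℝ (Fin 3) → EuclideanSpace ℝ (Fin 3))
        (p : ℝ → EuclideanSpace ℝ (Fin 3) → ℝ),
        Literature.Analysis.FluidPDE.IsClassicalNSSolutionOn (Set.Ico 0 T) ν 0 u p →
        Literature.Analysis.FluidPDE.IsLerayHopfOn T ν 0 (u 0) u →
        Literature.Analysis.FluidPDE.HasRapidSpatialDecay (u 0) →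
        ∀ l : ℝ, 0 < l → ∃ τ : ℝ, 0 < τ ∧ τ < T ∧ ∃ r : ℝ, 0 < r ∧ r ≤ ν / l ∧ r ^ 2 ≤ ν * τ ∧
          ∃ C : ℝ, ∀ t ∈ Set.Ico 0 T,
            MeasureTheory.IntegrableOn
              (fun z : ℝ × EuclideanSpace ℝ (Fin 3) =>
                inner ℝ (Literature.Analysis.FluidPDE.curl (u z.1) z.2)
                  (fderiv ℝ (u z.1) z.2 (Literature.Analysis.FluidPDE.curl (u z.1) z.2)))
              ({z : ℝ × EuclideanSpace ℝ (Fin 3) | z.1 ∈ Set.Ioo 0 t ∧ ‖u z.1 z.2‖ ≤ l} ∩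
                {z : ℝ × EuclideanSpace ℝ (Fin 3) | τ ≤ z.1 ∧
                  ∃ s ∈ Set.Icc (z.1 - r ^ 2 / ν) z.1, ∃ y ∈ Metric.closedBall z.2 r,
                    l < ‖u s y‖}) ∧
            ∫ z in ({z : ℝ × EuclideanSpace ℝ (Fin 3) | z.1 ∈ Set.Ioo 0 t ∧ ‖u z.1 z.2‖ ≤ l} ∩
                {z : ℝ × EuclideanSpace ℝ (Fin 3) | τ ≤ z.1 ∧
                  ∃ s ∈ Set.Icc (z.1 - r ^ 2 / ν) z.1, ∃ y ∈ Metric.closedBall z.2 r,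
                    l < ‖u s y‖}),
              inner ℝ (Literature.Analysis.FluidPDE.curl (u z.1) z.2)
                (fderiv ℝ (u z.1) z.2 (Literature.Analysis.FluidPDE.curl (u z.1) z.2)) ≤ C := by
  sorry

/-! ## Glue (sorry-free) -/

section Glue

variable (u : ℝ → EuclideanSpace ℝ (Fin 3) → EuclideanSpace ℝ (Fin 3))

/-- The enstrophy-production density `⟪ω, ∇u ω⟫` at a space-time point (glue abbreviation). -/
private def production (z : ℝ × EuclideanSpace ℝ (Fin 3)) : ℝ :=
  inner ℝ (Literature.Analysis.FluidPDE.curl (u z.1) z.2)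
    (fderiv ℝ (u z.1) z.2 (Literature.Analysis.FluidPDE.curl (u z.1) z.2))

/-- The slow space-time class up to time `t` at level `l` (glue abbreviation). -/
private def slowSet (l t : ℝ) : Set (ℝ × EuclideanSpace ℝ (Fin 3)) :=
  {z : ℝ × EuclideanSpace ℝ (Fin 3) | z.1 ∈ Set.Ioo 0 t ∧ ‖u z.1 z.2‖ ≤ l}

/-- The deep region: delay at least `τ` and a slow backward `(r²/ν, r)`-cylinder. -/
private def deepSet (ν l τ r : ℝ) : Set (ℝ × EuclideanSpace ℝ (Fin 3)) :=
  {z : ℝ × EuclideanSpace ℝ (Fin 3) | τ ≤ z.1 ∧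
    ∀ s ∈ Set.Icc (z.1 - r ^ 2 / ν) z.1, ∀ y ∈ Metric.closedBall z.2 r, ‖u s y‖ ≤ l}

/-- The collar region: delay at least `τ` and a fast point in the backward cylinder. -/
private def collarSet (ν l τ r : ℝ) : Set (ℝ × EuclideanSpace ℝ (Fin 3)) :=
  {z : ℝ × EuclideanSpace ℝ (Fin 3) | τ ≤ z.1 ∧
    ∃ s ∈ Set.Icc (z.1 - r ^ 2 / ν) z.1, ∃ y ∈ Metric.closedBall z.2 r, l < ‖u s y‖}

/-- Closed proxy of the deep region inside the slab `τ ≤ s ≤ t`: an intersection over the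
compact parameter set of the cylinder of closed sublevel conditions. -/
private def proxySet (ν l τ r t : ℝ) : Set (ℝ × EuclideanSpace ℝ (Fin 3)) :=
  ⋂ σ ∈ Set.Icc (0 : ℝ) (r ^ 2 / ν), ⋂ η ∈ Metric.closedBall (0 : EuclideanSpace ℝ (Fin 3)) r,
    ({z : ℝ × EuclideanSpace ℝ (Fin 3) | z.1 ∈ Set.Icc τ t} ∩
      (fun z : ℝ × EuclideanSpace ℝ (Fin 3) => u (z.1 - σ) (z.2 + η)) ⁻¹'
        Metric.closedBall (0 : EuclideanSpace ℝ (Fin 3)) l)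

variable {u}

/-- The proxy is closed, hence measurable, as soon as `u` is continuous on `[0,T) × ℝ³`,
`r² ≤ ν τ` and `t < T` (every shifted cylinder point stays in the domain of continuity). -/
private theorem measurableSet_proxySet {ν l τ r t T : ℝ} (hν : 0 < ν) (hrτ : r ^ 2 ≤ ν * τ)
    (htT : t < T)
    (hU : ContinuousOn (Function.uncurry u) (Set.Ico 0 T ×ˢ (Set.univ : Set (EuclideanSpace ℝ (Fin 3))))) :
    MeasurableSet (proxySet u ν l τ r t) := by
  refine IsClosed.measurableSet ?_
  refine isClosed_biInter fun σ hσ => isClosed_biInter fun η _ => ?_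
  refine ContinuousOn.preimage_isClosed_of_isClosed ?_ (isClosed_Icc.preimage continuous_fst)
    Metric.isClosed_closedBall
  have hg : Continuous fun z : ℝ × EuclideanSpace ℝ (Fin 3) =>
      ((z.1 - σ, z.2 + η) : ℝ × EuclideanSpace ℝ (Fin 3)) :=
    (continuous_fst.sub continuous_const).prodMk (continuous_snd.add continuous_const)
  have hστ : r ^ 2 / ν ≤ τ := by
    rw [div_le_iff₀ hν]
    linarith
  have hmaps : Set.MapsTo (fun z : ℝ × EuclideanSpace ℝ (Fin 3) =>
      ((z.1 - σ, z.2 + η) : ℝ × EuclideanSpace ℝ (Fin 3)))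
      {z : ℝ × EuclideanSpace ℝ (Fin 3) | z.1 ∈ Set.Icc τ t}
      (Set.Ico 0 T ×ˢ (Set.univ : Set (EuclideanSpace ℝ (Fin 3)))) := by
    intro z hz
    refine Set.mk_mem_prod ⟨?_, ?_⟩ (Set.mem_univ _)
    · have h1 := hσ.2
      have h2 := hz.1
      linarith
    · have h1 := hσ.1
      have h2 := hz.2
      linarith
  exact hU.comp hg.continuousOn hmaps

/-- Inside the slow class beyond the delay, the proxy cuts out exactly the deep piece. -/
private theorem sdiff_inter_proxySet {ν l τ r t : ℝ} :
    (slowSet u l t \ {z : ℝ × EuclideanSpace ℝ (Fin 3) | z.1 < τ}) ∩ proxySet u ν l τ r t =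
      slowSet u l t ∩ deepSet u ν l τ r := by
  ext z
  simp only [slowSet, deepSet, proxySet, Set.mem_inter_iff, Set.mem_sdiff, Set.mem_setOf_eq,
    Set.mem_iInter, Set.mem_preimage, Metric.mem_closedBall, dist_zero_right, not_lt, Set.mem_Icc,
    Set.mem_Ioo]
  constructor
  · rintro ⟨⟨⟨hzt, hzl⟩, hτz⟩, hM⟩
    refine ⟨⟨hzt, hzl⟩, hτz, fun s hs y hy => ?_⟩
    have hy' : ‖y - z.2‖ ≤ r := by rwa [← dist_eq_norm]
    have h := hM (z.1 - s) ⟨by linarith [hs.2], by linarith [hs.1]⟩ (y - z.2) hy'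
    simpa [sub_sub_cancel, add_sub_cancel] using h.2
  · rintro ⟨⟨hzt, hzl⟩, hτz, hD⟩
    refine ⟨⟨⟨hzt, hzl⟩, hτz⟩, fun σ hσ η hη => ⟨⟨hτz, hzt.2.le⟩, ?_⟩⟩
    refine hD (z.1 - σ) ⟨by linarith [hσ.2], by linarith [hσ.1]⟩ (z.2 + η) ?_
    simpa [dist_eq_norm] using hη

/-- Inside the slow class beyond the delay, the complement of the proxy is exactly the collar. -/
private theorem sdiff_sdiff_proxySet {ν l τ r t : ℝ} :
    (slowSet u l t \ {z : ℝ × EuclideanSpace ℝ (Fin 3) | z.1 < τ}) \ proxySet u ν l τ r t =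
      slowSet u l t ∩ collarSet u ν l τ r := by
  ext z
  simp only [slowSet, collarSet, proxySet, Set.mem_inter_iff, Set.mem_sdiff, Set.mem_setOf_eq,
    Set.mem_iInter, Set.mem_preimage, Metric.mem_closedBall, dist_zero_right, not_lt, Set.mem_Icc,
    Set.mem_Ioo]
  constructor
  · rintro ⟨⟨⟨hzt, hzl⟩, hτz⟩, hM⟩
    push Not at hM
    obtain ⟨σ, hσ, η, hη, hfast⟩ := hM
    refine ⟨⟨hzt, hzl⟩, hτz, z.1 - σ, ⟨by linarith [hσ.2], by linarith [hσ.1]⟩, z.2 + η, ?_, ?_⟩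
    · simpa [dist_eq_norm] using hη
    · exact hfast ⟨hτz, hzt.2.le⟩
  · rintro ⟨⟨hzt, hzl⟩, hτz, s, hs, y, hy, hfast⟩
    refine ⟨⟨⟨hzt, hzl⟩, hτz⟩, fun hM => ?_⟩
    have hy' : ‖y - z.2‖ ≤ r := by rwa [← dist_eq_norm]
    have h := hM (z.1 - s) ⟨by linarith [hs.2], by linarith [hs.1]⟩ (y - z.2) hy'
    have h2 : ‖u s y‖ ≤ l := by simpa [sub_sub_cancel, add_sub_cancel] using h.2
    exact absurd h2 (not_le.mpr hfast)

end Glue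

/-- **Birth composition, hypothesis form (real proof, no `sorry`).**  The three stub STATEMENTS
imply the crux statement, written out verbatim (`SlowClassProduction_of` below restates the
conclusion BY NAME from the declared stubs).  Proof: get `(τ, r, C₂)` from the collar budget,
`C₁` from the deep budget at the same `(τ, r)`, `C₀ := ∫∫_{(0,τ)×ℝ³} |P|` from the slab
integrability; split `S_t` along `{s < τ}` and then along the closed proxy of the deep region
(`integral_inter_add_sdiff` twice), identify the two far pieces with the deep and collar pieces,
and add: `∫_{S_t} P ≤ C₀ + C₁ + C₂`. -/
theorem SlowClassProduction_of_stubs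
    (h₁ : ∀ (ν T : ℝ), 0 < ν → 0 < T →
      ∀ (u : ℝ → EuclideanSpace ℝ (Fin 3) → EuclideanSpace ℝ (Fin 3))
        (p : ℝ → EuclideanSpace ℝ (Fin 3) → ℝ),
        Literature.Analysis.FluidPDE.IsClassicalNSSolutionOn (Set.Ico 0 T) ν 0 u p →
        Literature.Analysis.FluidPDE.IsLerayHopfOn T ν 0 (u 0) u →
        Literature.Analysis.FluidPDE.HasRapidSpatialDecay (u 0) →
        ∀ t₁ : ℝ, 0 < t₁ → t₁ < T →
          MeasureTheory.IntegrableOn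
            (fun z : ℝ × EuclideanSpace ℝ (Fin 3) =>
              inner ℝ (Literature.Analysis.FluidPDE.curl (u z.1) z.2)
                (fderiv ℝ (u z.1) z.2 (Literature.Analysis.FluidPDE.curl (u z.1) z.2)))
            (Set.Ioo 0 t₁ ×ˢ (Set.univ : Set (EuclideanSpace ℝ (Fin 3)))))
    (h₂ : ∀ (ν T : ℝ), 0 < ν → 0 < T →
      ∀ (u : ℝ → EuclideanSpace ℝ (Fin 3) → EuclideanSpace ℝ (Fin 3))
        (p : ℝ → EuclideanSpace ℝ (Fin 3) → ℝ),
        Literature.Analysis.FluidPDE.IsClassicalNSSolutionOn (Set.Ico 0 T) ν 0 u p →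
        Literature.Analysis.FluidPDE.IsLerayHopfOn T ν 0 (u 0) u →
        Literature.Analysis.FluidPDE.HasRapidSpatialDecay (u 0) →
        ∀ l : ℝ, 0 < l → ∀ τ : ℝ, 0 < τ → τ < T → ∀ r : ℝ, 0 < r → r ≤ ν / l → r ^ 2 ≤ ν * τ →
          ∃ C : ℝ, ∀ t ∈ Set.Ico 0 T,
            MeasureTheory.IntegrableOn
              (fun z : ℝ × EuclideanSpace ℝ (Fin 3) =>
                inner ℝ (Literature.Analysis.FluidPDE.curl (u z.1) z.2)
                  (fderiv ℝ (u z.1) z.2 (Literature.Analysis.FluidPDE.curl (u z.1) z.2)))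
              ({z : ℝ × EuclideanSpace ℝ (Fin 3) | z.1 ∈ Set.Ioo 0 t ∧ ‖u z.1 z.2‖ ≤ l} ∩
                {z : ℝ × EuclideanSpace ℝ (Fin 3) | τ ≤ z.1 ∧
                  ∀ s ∈ Set.Icc (z.1 - r ^ 2 / ν) z.1, ∀ y ∈ Metric.closedBall z.2 r,
                    ‖u s y‖ ≤ l}) ∧
            ∫ z in ({z : ℝ × EuclideanSpace ℝ (Fin 3) | z.1 ∈ Set.Ioo 0 t ∧ ‖u z.1 z.2‖ ≤ l} ∩
                {z : ℝ × EuclideanSpace ℝ (Fin 3) | τ ≤ z.1 ∧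
                  ∀ s ∈ Set.Icc (z.1 - r ^ 2 / ν) z.1, ∀ y ∈ Metric.closedBall z.2 r,
                    ‖u s y‖ ≤ l}),
              |inner ℝ (Literature.Analysis.FluidPDE.curl (u z.1) z.2)
                (fderiv ℝ (u z.1) z.2 (Literature.Analysis.FluidPDE.curl (u z.1) z.2))| ≤ C)
    (h₃ : ∀ (ν T : ℝ), 0 < ν → 0 < T →
      ∀ (u : ℝ → EuclideanSpace ℝ (Fin 3) → EuclideanSpace ℝ (Fin 3))
        (p : ℝ → EuclideanSpace ℝ (Fin 3) → ℝ),
        Literature.Analysis.FluidPDE.IsClassicalNSSolutionOn (Set.Ico 0 T) ν 0 u p →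
        Literature.Analysis.FluidPDE.IsLerayHopfOn T ν 0 (u 0) u →
        Literature.Analysis.FluidPDE.HasRapidSpatialDecay (u 0) →
        ∀ l : ℝ, 0 < l → ∃ τ : ℝ, 0 < τ ∧ τ < T ∧ ∃ r : ℝ, 0 < r ∧ r ≤ ν / l ∧ r ^ 2 ≤ ν * τ ∧
          ∃ C : ℝ, ∀ t ∈ Set.Ico 0 T,
            MeasureTheory.IntegrableOn
              (fun z : ℝ × EuclideanSpace ℝ (Fin 3) =>
                inner ℝ (Literature.Analysis.FluidPDE.curl (u z.1) z.2)
                  (fderiv ℝ (u z.1) z.2 (Literature.Analysis.FluidPDE.curl (u z.1) z.2)))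
              ({z : ℝ × EuclideanSpace ℝ (Fin 3) | z.1 ∈ Set.Ioo 0 t ∧ ‖u z.1 z.2‖ ≤ l} ∩
                {z : ℝ × EuclideanSpace ℝ (Fin 3) | τ ≤ z.1 ∧
                  ∃ s ∈ Set.Icc (z.1 - r ^ 2 / ν) z.1, ∃ y ∈ Metric.closedBall z.2 r,
                    l < ‖u s y‖}) ∧
            ∫ z in ({z : ℝ × EuclideanSpace ℝ (Fin 3) | z.1 ∈ Set.Ioo 0 t ∧ ‖u z.1 z.2‖ ≤ l} ∩
                {z : ℝ × EuclideanSpace ℝ (Fin 3) | τ ≤ z.1 ∧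
                  ∃ s ∈ Set.Icc (z.1 - r ^ 2 / ν) z.1, ∃ y ∈ Metric.closedBall z.2 r,
                    l < ‖u s y‖}),
              inner ℝ (Literature.Analysis.FluidPDE.curl (u z.1) z.2)
                (fderiv ℝ (u z.1) z.2 (Literature.Analysis.FluidPDE.curl (u z.1) z.2)) ≤ C) :
    ∀ (ν T : ℝ), 0 < ν → 0 < T →
      ∀ (u : ℝ → EuclideanSpace ℝ (Fin 3) → EuclideanSpace ℝ (Fin 3))
        (p : ℝ → EuclideanSpace ℝ (Fin 3) → ℝ),
        Literature.Analysis.FluidPDE.IsClassicalNSSolutionOn (Set.Ico 0 T) ν 0 u p →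
        Literature.Analysis.FluidPDE.IsLerayHopfOn T ν 0 (u 0) u →
        Literature.Analysis.FluidPDE.HasRapidSpatialDecay (u 0) →
        ∀ l : ℝ, 0 < l → ∃ C : ℝ, ∀ t ∈ Set.Ico 0 T,
          MeasureTheory.IntegrableOn
            (fun z : ℝ × EuclideanSpace ℝ (Fin 3) =>
              inner ℝ (Literature.Analysis.FluidPDE.curl (u z.1) z.2)
                (fderiv ℝ (u z.1) z.2 (Literature.Analysis.FluidPDE.curl (u z.1) z.2)))
            {z : ℝ × EuclideanSpace ℝ (Fin 3) | z.1 ∈ Set.Ioo 0 t ∧ ‖u z.1 z.2‖ ≤ l} ∧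
          ∫ z in {z : ℝ × EuclideanSpace ℝ (Fin 3) | z.1 ∈ Set.Ioo 0 t ∧ ‖u z.1 z.2‖ ≤ l},
            inner ℝ (Literature.Analysis.FluidPDE.curl (u z.1) z.2)
              (fderiv ℝ (u z.1) z.2 (Literature.Analysis.FluidPDE.curl (u z.1) z.2)) ≤ C := by
  intro ν T hν hT u p hcl hLH hdec l hl
  obtain ⟨τ, hτ0, hτT, r, hr0, hrl, hrτ, C₂, hK⟩ := h₃ ν T hν hT u p hcl hLH hdec l hl
  obtain ⟨C₁, hD⟩ := h₂ ν T hν hT u p hcl hLH hdec l hl τ hτ0 hτT r hr0 hrl hrτ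
  have hI : IntegrableOn (production u)
      (Set.Ioo 0 τ ×ˢ (Set.univ : Set (EuclideanSpace ℝ (Fin 3)))) :=
    h₁ ν T hν hT u p hcl hLH hdec τ hτ0 hτT
  refine ⟨(∫ z in Set.Ioo 0 τ ×ˢ (Set.univ : Set (EuclideanSpace ℝ (Fin 3))), |production u z|)
    + C₁ + C₂, ?_⟩
  intro t ht
  change IntegrableOn (production u) (slowSet u l t) ∧ ∫ z in slowSet u l t, production u z ≤ _
  have hDt : IntegrableOn (production u) (slowSet u l t ∩ deepSet u ν l τ r) ∧
      ∫ z in slowSet u l t ∩ deepSet u ν l τ r, |production u z| ≤ C₁ := hD t ht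
  have hKt : IntegrableOn (production u) (slowSet u l t ∩ collarSet u ν l τ r) ∧
      ∫ z in slowSet u l t ∩ collarSet u ν l τ r, production u z ≤ C₂ := hK t ht
  -- continuity of the velocity on `[0,T) × ℝ³`
  have hsm : ContDiffOn ℝ ∞ (Function.uncurry u)
      (Set.Ico 0 T ×ˢ (Set.univ : Set (EuclideanSpace ℝ (Fin 3)))) := hcl.smooth_velocity
  have hU : ContinuousOn (Function.uncurry u)
      (Set.Ico 0 T ×ˢ (Set.univ : Set (EuclideanSpace ℝ (Fin 3)))) := hsm.continuousOn
  -- the two measurable cuts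
  have hA : MeasurableSet {z : ℝ × EuclideanSpace ℝ (Fin 3) | z.1 < τ} :=
    measurableSet_lt measurable_fst measurable_const
  have hM : MeasurableSet (proxySet u ν l τ r t) := measurableSet_proxySet hν hrτ ht.2 hU
  have hDM : (slowSet u l t \ {z : ℝ × EuclideanSpace ℝ (Fin 3) | z.1 < τ}) ∩ proxySet u ν l τ r t =
      slowSet u l t ∩ deepSet u ν l τ r := sdiff_inter_proxySet
  have hKM : (slowSet u l t \ {z : ℝ × EuclideanSpace ℝ (Fin 3) | z.1 < τ}) \ proxySet u ν l τ r t =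
      slowSet u l t ∩ collarSet u ν l τ r := sdiff_sdiff_proxySet
  -- the initial piece sits in the slab `(0,τ) × ℝ³`
  have hsub : slowSet u l t ∩ {z : ℝ × EuclideanSpace ℝ (Fin 3) | z.1 < τ} ⊆
      Set.Ioo 0 τ ×ˢ (Set.univ : Set (EuclideanSpace ℝ (Fin 3))) := by
    rintro z ⟨⟨hzt, _⟩, hzτ⟩
    exact Set.mk_mem_prod ⟨hzt.1, hzτ⟩ (Set.mem_univ _)
  have hIA : IntegrableOn (production u)
      (slowSet u l t ∩ {z : ℝ × EuclideanSpace ℝ (Fin 3) | z.1 < τ}) := hI.mono_set hsub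
  -- integrability beyond the delay and on the whole slow class
  have hfar : slowSet u l t \ {z : ℝ × EuclideanSpace ℝ (Fin 3) | z.1 < τ} =
      (slowSet u l t ∩ deepSet u ν l τ r) ∪ (slowSet u l t ∩ collarSet u ν l τ r) := by
    rw [← hDM, ← hKM, Set.inter_union_sdiff]
  have hSA : IntegrableOn (production u)
      (slowSet u l t \ {z : ℝ × EuclideanSpace ℝ (Fin 3) | z.1 < τ}) := by
    rw [hfar]
    exact hDt.1.union hKt.1
  have hS : IntegrableOn (production u) (slowSet u l t) := by
    rw [← Set.inter_union_sdiff (slowSet u l t) {z : ℝ × EuclideanSpace ℝ (Fin 3) | z.1 < τ}]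
    exact hIA.union hSA
  refine ⟨hS, ?_⟩
  -- split the integral twice
  have e1 := integral_inter_add_sdiff hA hS
  have e2 := integral_inter_add_sdiff hM hSA
  rw [hDM, hKM] at e2
  -- bound the three pieces
  have b0 : ∫ z in slowSet u l t ∩ {z : ℝ × EuclideanSpace ℝ (Fin 3) | z.1 < τ}, production u z ≤
      ∫ z in Set.Ioo 0 τ ×ˢ (Set.univ : Set (EuclideanSpace ℝ (Fin 3))), |production u z| :=
    calc ∫ z in slowSet u l t ∩ {z : ℝ × EuclideanSpace ℝ (Fin 3) | z.1 < τ}, production u z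
        ≤ ∫ z in slowSet u l t ∩ {z : ℝ × EuclideanSpace ℝ (Fin 3) | z.1 < τ}, |production u z| :=
          integral_mono hIA hIA.abs fun z => le_abs_self _
      _ ≤ ∫ z in Set.Ioo 0 τ ×ˢ (Set.univ : Set (EuclideanSpace ℝ (Fin 3))), |production u z| :=
          setIntegral_mono_set hI.abs (ae_of_all _ fun z => abs_nonneg _)
            hsub.eventuallyLE
  have b1 : ∫ z in slowSet u l t ∩ deepSet u ν l τ r, production u z ≤ C₁ :=
    le_trans (integral_mono hDt.1 hDt.1.abs fun z => le_abs_self _) hDt.2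
  have b2 : ∫ z in slowSet u l t ∩ collarSet u ν l τ r, production u z ≤ C₂ := hKt.2
  rw [← e1, ← e2]
  linarith

/-- **The registered skeleton: the crux BY NAME from the three declared stubs** (A12 layer
invariant — no `Prop` hypotheses; the placeholders live only inside `stub_slabProduction`,
`stub_deepSlowProduction`, `stub_collarProduction`, which it uses by name; the composition itself,
`SlowClassProduction_of_stubs`, is closed). -/
theorem SlowClassProduction_of :
    _root_.Summit.NavierStokesRegularity.NavierStokesRegularity.Theses.HodographBetchov.SlowClassProduction :=
  SlowClassProduction_of_stubs stub_slabProduction stub_deepSlowProduction stub_collarProduction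

end Summit.NavierStokesRegularity.NavierStokesRegularity.Cruxes.SlowClassProduction.Birth
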